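import Summits.AnomalousDissipation.AnomalousDissipation.Theorems.EnsembleRigidityDefs
import Summits.AnomalousDissipation.AnomalousDissipation.Theorems.EnsembleRigidityResidualTransferSSSEnsembleCS
import Summits.AnomalousDissipation.AnomalousDissipation.Theorems.EnsembleRigidityResidualTransferSSSTestEnstrophyTame
import Literature.Analysis.FluidPDE.CylindricalGenerator
import Literature.Analysis.FluidPDE.StatisticalSolutionProofs
import HarnessLib

/-!
# Stub `stub_weakDuality` (W) of line `Sketch` (crux stmt-AnomalousDissipation-15508,
  `EnsembleRigidity.GPStatisticalRigidity`)

√-LINEARISED WEAK DUALITY (idea `odd-lyapunov-certificate-family`; Rosa–Temam, auxiliary-functional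
side of the minimax for stationary statistical solutions). Fix a force `f`, an energy level `E > 0`,
a margin `γ > 0` and a relative `H¹`-cost `C > 0`. Suppose that for every roughness scale `Λ > 0`
there is a cylindrical test functional `Ψ = Ψ_Λ` on the energy space `H` of `T³` and constants
`a`, `b ≥ 0` with `γ ≤ a − bE`, the cost bound `‖∇Ψ'(v)‖² ≤ C²(1 + ‖∇v‖²)` on `H`, and the pointwise
forced-Euler Lyapunov inequality

  `a − b|v|² − Λ⁻¹ ‖∇v‖ ‖∇Ψ'(v)‖ ≤ ⟨f − B(v,v), Ψ'(v)⟩`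

at every finite-enstrophy `v ∈ H`. Then with `c = δ₀ = γ/(4C)`: every Borel probability measure `μ`
on `H` with integrable energy, mean energy `≤ E`, finite mean enstrophy `G` and cylindrical
forced-Euler defect `|∫ ⟨f − B(v,v), Φ'(v)⟩ dμ| ≤ R (∫ ‖∇Φ'(v)‖² dμ)^{1/2}` (all cylindrical `Φ`),
`0 ≤ R ≤ δ₀`, satisfies `c ≤ R √G`.

## Proof

Given `μ`, set `G := ∫ ‖∇v‖² dμ` and choose `Λ := 2C(1+G)/γ` AFTER seeing `μ`. The pointwise
inequality holds `μ`-a.e. (finite enstrophy a.e., `ae_lt_top`); integrate it (`integral_mono_ae`):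
the left side integrates to `a − b ∫|v|² − Λ⁻¹ ∫ ‖∇v‖ ‖∇Ψ'(v)‖`, the right side is at most
`R X`, `X := (∫ ‖∇Ψ'(v)‖² dμ)^{1/2}`, by the defect clause at `Φ = Ψ`. Cauchy–Schwarz in `L²(μ)`
(`ResidualTransferSSS.stub_ensembleCS`) gives `∫ ‖∇v‖ ‖∇Ψ'(v)‖ ≤ √G X`, and integrating the cost
bound gives `X ≤ C √(1+G)` (the test enstrophy is bounded and continuous on `H`,
`ResidualTransferSSS.stub_testEnstrophyTame`, hence integrable). With `∫|v|² ≤ E`, `b ≥ 0`: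
`γ ≤ a − bE ≤ (R + Λ⁻¹ √G) C √(1+G) ≤ R C √(1+G) + γ/2` (`weakDuality_integrate`), so
`γ/2 ≤ R C √(1+G)`; if `G ≥ 1` then `√(1+G) ≤ 2√G` and `R √G ≥ γ/(4C)`, while if `G < 1` then
`√(1+G) < 2` forces `R > γ/(4C) = δ₀`, excluded (`weakDuality_arith`).

## References

* C. Foias, O. Manley, R. Rosa, R. Temam, *Navier–Stokes Equations and Turbulence* (CUP 2001),
  Ch. IV §1.2 Def. 1.3, (1.29)–(1.31) (stationary statistical solutions, mean enstrophy).
* R. Rosa, R. Temam, arXiv:2010.06730 (auxiliary functionals / minimax for statistical solutions).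
-/

-- `Summit.<Summit>.<Problem>` is the tree's mandated summit-side namespace (CONVENTIONS §2); single-conjunct summit, duplicate deliberate.
set_option linter.dupNamespace false

noncomputable section

namespace Summit.AnomalousDissipation.AnomalousDissipation.Theorems.EnsembleRigidity.GPStatisticalRigidity

open MeasureTheory Filter Topology UnitAddTorus
open scoped InnerProductSpace RealInnerProductSpace ENNReal NNReal
open Literature.Analysis.FunctionSpaces Literature.Analysis.FluidPDE
open Summit.AnomalousDissipation.AnomalousDissipation.Theorems.EnsembleRigidity

/-- Local notation: real vector fields on `T³`. -/
local notation "Vec3" => (UnitAddTorus (Fin 3)) → (EuclideanSpace ℝ (Fin 3))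
/-- Local notation: `L²(T³; ℝ³)`. -/
local notation "L2" => (Lp (EuclideanSpace ℝ (Fin 3)) 2 (volume : Measure (UnitAddTorus (Fin 3))))
/-- Local notation: the energy space `H`. -/
local notation "H3" => (Torus.energySpace (Fin 3))

/-- **Integrated certificate inequality.** For a probability measure `μ` on `H` with integrable
energy and finite mean enstrophy `G`, a cylindrical `Ψ` with cost `‖∇Ψ'(v)‖² ≤ C²(1 + ‖∇v‖²)` and the
pointwise inequality `a − b|v|² − Λ⁻¹ ‖∇v‖ ‖∇Ψ'(v)‖ ≤ ⟨f − B(v,v), Ψ'(v)⟩` at finite-enstrophy `v`,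
and the defect bound `|∫ ⟨f − B(v,v), Ψ'(v)⟩ dμ| ≤ R (∫ ‖∇Ψ'(v)‖² dμ)^{1/2}` (integrand integrable),
one has `a − b ∫|v|² dμ ≤ (R + Λ⁻¹ √G) · C √(1+G)`: integrate the pointwise inequality
(`integral_mono_ae`, finite enstrophy `μ`-a.e.), Cauchy–Schwarz in `L²(μ)` for `∫ ‖∇v‖ ‖∇Ψ'(v)‖`,
and `∫ ‖∇Ψ'(v)‖² ≤ C²(1+G)`. [folklore] -/
theorem weakDuality_integrate (f : Vec3) (μ : Measure H3) [IsProbabilityMeasure μ]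
    (hint : Integrable (fun v : H3 => ‖v‖ ^ 2) μ) (hGfin : Torus.ensembleEnstrophy μ < ⊤)
    (Ψ : Torus.CylindricalTest (Fin 3)) {a b Λ C R : ℝ} (hΛ : 0 < Λ) (hC : 0 < C) (hR : 0 ≤ R)
    (hcost : ∀ v : H3, Torus.gradNormSq (Ψ.grad v) ≤
        C ^ 2 * (1 + (Torus.eGradNormSq ((v : L2) : Vec3)).toReal))
    (hcert : ∀ v : H3, Torus.eGradNormSq ((v : L2) : Vec3) ≠ ⊤ →
        a - b * ‖v‖ ^ 2 -
            Λ⁻¹ * (Real.sqrt (Torus.eGradNormSq ((v : L2) : Vec3)).toReal *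
              Real.sqrt (Torus.gradNormSq (Ψ.grad v))) ≤
          Torus.nsGeneratorPairing 0 f v (Ψ.grad v))
    (hdefI : Integrable (fun v : H3 => Torus.nsGeneratorPairing 0 f v (Ψ.grad v)) μ)
    (hdef : |∫ v, Torus.nsGeneratorPairing 0 f v (Ψ.grad v) ∂μ| ≤
              R * Real.sqrt (∫ v, Torus.gradNormSq (Ψ.grad v) ∂μ)) :
    a - b * Torus.ensembleEnergy μ ≤
      (R + Λ⁻¹ * Real.sqrt (Torus.ensembleEnstrophy μ).toReal) *
        (C * Real.sqrt (1 + (Torus.ensembleEnstrophy μ).toReal)) := by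
  -- (1) the enstrophy density: measurable, finite a.e., integrable, of integral `G`
  have hGm : Measurable fun u : H3 => Torus.eGradNormSq ((u : L2) : Vec3) :=
    Torus.measurable_eGradNormSq_coe
  have hGlt : ∀ᵐ u : H3 ∂μ, Torus.eGradNormSq ((u : L2) : Vec3) < ⊤ := ae_lt_top hGm hGfin.ne
  have haI : Integrable (fun u : H3 => (Torus.eGradNormSq ((u : L2) : Vec3)).toReal) μ :=
    integrable_toReal_of_lintegral_ne_top hGm.aemeasurable hGfin.ne
  have ha0 : 0 ≤ᵐ[μ] fun u : H3 => (Torus.eGradNormSq ((u : L2) : Vec3)).toReal :=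
    ae_of_all _ fun u => ENNReal.toReal_nonneg
  have hGa : ∫ u : H3, (Torus.eGradNormSq ((u : L2) : Vec3)).toReal ∂μ =
      (Torus.ensembleEnstrophy μ).toReal := by
    rw [Torus.ensembleEnstrophy, integral_toReal hGm.aemeasurable hGlt]
  -- (2) the test enstrophy: continuous and bounded on `H`, hence integrable; `∫ ≤ C²(1+G)`
  obtain ⟨hbc, C', hC'⟩ := ResidualTransferSSS.stub_testEnstrophyTame Ψ
  have hbI : Integrable (fun u : H3 => Torus.gradNormSq (Ψ.grad u)) μ := by
    refine Integrable.mono' (integrable_const (max C' 0)) hbc.aestronglyMeasurable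
      (ae_of_all _ fun u => ?_)
    rw [Real.norm_of_nonneg (Torus.gradNormSq_nonneg _)]
    exact (hC' u).trans (le_max_left _ _)
  have hb0 : 0 ≤ᵐ[μ] fun u : H3 => Torus.gradNormSq (Ψ.grad u) :=
    ae_of_all _ fun u => Torus.gradNormSq_nonneg _
  have hX : Real.sqrt (∫ u, Torus.gradNormSq (Ψ.grad u) ∂μ) ≤
      C * Real.sqrt (1 + (Torus.ensembleEnstrophy μ).toReal) := by
    have h1 : Integrable
        (fun u : H3 => C ^ 2 * (1 + (Torus.eGradNormSq ((u : L2) : Vec3)).toReal)) μ :=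
      ((integrable_const (1 : ℝ)).add haI).const_mul (C ^ 2)
    have h2 : ∫ u, Torus.gradNormSq (Ψ.grad u) ∂μ ≤
        C ^ 2 * (1 + (Torus.ensembleEnstrophy μ).toReal) := by
      calc ∫ u, Torus.gradNormSq (Ψ.grad u) ∂μ
          ≤ ∫ u : H3, C ^ 2 * (1 + (Torus.eGradNormSq ((u : L2) : Vec3)).toReal) ∂μ :=
            integral_mono hbI h1 fun u => hcost u
        _ = C ^ 2 * (1 + (Torus.ensembleEnstrophy μ).toReal) := by
            rw [integral_const_mul, integral_add (integrable_const _) haI, integral_const, hGa,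
              probReal_univ, one_smul]
    calc Real.sqrt (∫ u, Torus.gradNormSq (Ψ.grad u) ∂μ)
        ≤ Real.sqrt (C ^ 2 * (1 + (Torus.ensembleEnstrophy μ).toReal)) := Real.sqrt_le_sqrt h2
      _ = C * Real.sqrt (1 + (Torus.ensembleEnstrophy μ).toReal) := by
          rw [Real.sqrt_mul (sq_nonneg C), Real.sqrt_sq hC.le]
  -- (3) Cauchy–Schwarz in `L²(μ)`: `∫ ‖∇v‖ ‖∇Ψ'(v)‖ ≤ √G · X`
  have hLI : Integrable (fun u : H3 => Real.sqrt (Torus.eGradNormSq ((u : L2) : Vec3)).toReal *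
      Real.sqrt (Torus.gradNormSq (Ψ.grad u))) μ :=
    (ResidualTransferSSS.memLp_two_sqrt_of_integrable ha0 haI).integrable_mul
      (ResidualTransferSSS.memLp_two_sqrt_of_integrable hb0 hbI)
  have hCS : ∫ u : H3, Real.sqrt (Torus.eGradNormSq ((u : L2) : Vec3)).toReal *
      Real.sqrt (Torus.gradNormSq (Ψ.grad u)) ∂μ ≤
      Real.sqrt (Torus.ensembleEnstrophy μ).toReal *
        Real.sqrt (∫ u, Torus.gradNormSq (Ψ.grad u) ∂μ) := by
    have h := ResidualTransferSSS.stub_ensembleCS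
      (L := fun u : H3 => Real.sqrt (Torus.eGradNormSq ((u : L2) : Vec3)).toReal *
        Real.sqrt (Torus.gradNormSq (Ψ.grad u)))
      ha0 hb0 haI hbI (ae_of_all _ fun u =>
        (abs_of_nonneg (mul_nonneg (Real.sqrt_nonneg _) (Real.sqrt_nonneg _))).le)
    rw [hGa] at h
    exact (le_abs_self _).trans h
  -- (4) integrate the pointwise certificate inequality (valid `μ`-a.e.)
  have hae : ∀ᵐ v : H3 ∂μ, a - b * ‖v‖ ^ 2 -
      Λ⁻¹ * (Real.sqrt (Torus.eGradNormSq ((v : L2) : Vec3)).toReal *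
        Real.sqrt (Torus.gradNormSq (Ψ.grad v))) ≤
      Torus.nsGeneratorPairing 0 f v (Ψ.grad v) := by
    filter_upwards [hGlt] with v hv
    exact hcert v hv.ne
  have hL1 : Integrable (fun v : H3 => a - b * ‖v‖ ^ 2) μ :=
    (integrable_const a).sub (hint.const_mul b)
  have hL2 : Integrable (fun v : H3 =>
      Λ⁻¹ * (Real.sqrt (Torus.eGradNormSq ((v : L2) : Vec3)).toReal *
        Real.sqrt (Torus.gradNormSq (Ψ.grad v)))) μ := hLI.const_mul _
  have hLint : Integrable (fun v : H3 => a - b * ‖v‖ ^ 2 -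
      Λ⁻¹ * (Real.sqrt (Torus.eGradNormSq ((v : L2) : Vec3)).toReal *
        Real.sqrt (Torus.gradNormSq (Ψ.grad v)))) μ := hL1.sub hL2
  have hmono := integral_mono_ae hLint hdefI hae
  rw [integral_sub hL1 hL2, integral_sub (integrable_const a) (hint.const_mul b), integral_const,
    probReal_univ, one_smul, integral_const_mul, integral_const_mul] at hmono
  have hdef' : ∫ v, Torus.nsGeneratorPairing 0 f v (Ψ.grad v) ∂μ ≤
      R * Real.sqrt (∫ v, Torus.gradNormSq (Ψ.grad v) ∂μ) := (le_abs_self _).trans hdef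
  -- (5) combine
  have hΛ' : 0 ≤ Λ⁻¹ := inv_nonneg.2 hΛ.le
  have h3 : Λ⁻¹ * ∫ u : H3, Real.sqrt (Torus.eGradNormSq ((u : L2) : Vec3)).toReal *
      Real.sqrt (Torus.gradNormSq (Ψ.grad u)) ∂μ ≤
      Λ⁻¹ * (Real.sqrt (Torus.ensembleEnstrophy μ).toReal *
        Real.sqrt (∫ u, Torus.gradNormSq (Ψ.grad u) ∂μ)) :=
    mul_le_mul_of_nonneg_left hCS hΛ'
  have h4 : (R + Λ⁻¹ * Real.sqrt (Torus.ensembleEnstrophy μ).toReal) *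
      Real.sqrt (∫ u, Torus.gradNormSq (Ψ.grad u) ∂μ) ≤
      (R + Λ⁻¹ * Real.sqrt (Torus.ensembleEnstrophy μ).toReal) *
        (C * Real.sqrt (1 + (Torus.ensembleEnstrophy μ).toReal)) :=
    mul_le_mul_of_nonneg_left hX (add_nonneg hR (mul_nonneg hΛ' (Real.sqrt_nonneg _)))
  unfold Torus.ensembleEnergy
  linarith [hmono, hdef', h3, h4]

/-- **Arithmetic endgame of the weak duality.** From `γ ≤ a − bE`, `b ≥ 0`, `∫|v|² ≤ E` and the
integrated certificate inequality at the roughness scale `Λ = 2C(1+G)/γ`,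
`a − b∫|v|² ≤ (R + γ/(2C(1+G)) √G) · C √(1+G)`, one gets `γ/2 ≤ R C √(1+G)` (as
`√G √(1+G) ≤ 1 + G`), whence `γ/(4C) ≤ R √G`: for `G ≥ 1` by `√(1+G) ≤ 2√G`, and for `G < 1` the
bound `√(1+G) < 2` contradicts `R ≤ γ/(4C)`. [folklore] -/
theorem weakDuality_arith {γ C R G En E a b : ℝ} (hγ : 0 < γ) (hC : 0 < C) (hR : 0 ≤ R)
    (hRδ : R ≤ γ / (4 * C)) (hG : 0 ≤ G) (hb : 0 ≤ b) (hab : γ ≤ a - b * E) (hEn : En ≤ E)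
    (hcore : a - b * En ≤
      (R + γ / (2 * C * (1 + G)) * Real.sqrt G) * (C * Real.sqrt (1 + G))) :
    γ / (4 * C) ≤ R * Real.sqrt G := by
  have hS2 : Real.sqrt (1 + G) ^ 2 = 1 + G := Real.sq_sqrt (by positivity)
  have hs2 : Real.sqrt G ^ 2 = G := Real.sq_sqrt hG
  have hs0 : 0 ≤ Real.sqrt G := Real.sqrt_nonneg _
  have hS0 : 0 ≤ Real.sqrt (1 + G) := Real.sqrt_nonneg _
  have hsS : Real.sqrt G ≤ Real.sqrt (1 + G) := Real.sqrt_le_sqrt (by linarith)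
  -- the roughness term is at most `γ/2`
  have h1 : Real.sqrt G * Real.sqrt (1 + G) ≤ 1 + G := by
    nlinarith [mul_le_mul_of_nonneg_right hsS hS0]
  have hT : γ / (2 * C * (1 + G)) * Real.sqrt G * (C * Real.sqrt (1 + G)) ≤ γ / 2 := by
    calc γ / (2 * C * (1 + G)) * Real.sqrt G * (C * Real.sqrt (1 + G))
        = γ / (2 * C * (1 + G)) * (C * (Real.sqrt G * Real.sqrt (1 + G))) := by ring
      _ ≤ γ / (2 * C * (1 + G)) * (C * (1 + G)) :=
          mul_le_mul_of_nonneg_left (mul_le_mul_of_nonneg_left h1 hC.le) (by positivity)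
      _ = γ / 2 := by
          field_simp
  -- hence `γ/2 ≤ R C √(1+G)`
  have hEn' : b * En ≤ b * E := mul_le_mul_of_nonneg_left hEn hb
  have key : γ / 2 ≤ R * C * Real.sqrt (1 + G) := by linarith
  by_cases hG1 : 1 ≤ G
  · -- `√(1+G) ≤ 2√G`
    have hS : Real.sqrt (1 + G) ≤ 2 * Real.sqrt G := by
      rw [Real.sqrt_le_left (by positivity), mul_pow, hs2]
      linarith
    have h2 : R * C * Real.sqrt (1 + G) ≤ R * C * (2 * Real.sqrt G) :=
      mul_le_mul_of_nonneg_left hS (mul_nonneg hR hC.le)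
    rw [div_le_iff₀ (by positivity)]
    linarith
  · -- `√(1+G) < 2` forces `R > γ/(4C)`, excluded
    rw [not_le] at hG1
    have hS : Real.sqrt (1 + G) < 2 := by
      rw [Real.sqrt_lt' (by norm_num : (0 : ℝ) < 2)]
      linarith
    have h3 : R * (4 * C) ≤ γ := (le_div_iff₀ (by positivity)).1 hRδ
    rcases hR.eq_or_lt with h0 | hpos
    · rw [← h0, zero_mul, zero_mul] at key
      linarith
    · have h2 : R * C * Real.sqrt (1 + G) < R * C * 2 :=
        mul_lt_mul_of_pos_left hS (mul_pos hpos hC)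
      linarith

/-- **W `stub_weakDuality`** — √-LINEARISED WEAK DUALITY (idea `odd-lyapunov-certificate-family`;
Rosa–Temam arXiv:2010.06730, auxiliary-functional side). A Λ-family of cylindrical forced-Euler Lyapunov
certificates with uniform margin `γ` and uniform relative `H¹`-cost `C` at level `E > 0` yields the
crux's conclusion at level `E` with `c = δ₀ = γ/(4C)`: integrate the pointwise inequality against an
admissible `μ` (finite enstrophy `G`, so it holds `μ`-a.e.), bound `∫ ‖∇v‖ ‖∇Ψ'(v)‖ dμ ≤ √G · X` and
`X := (∫‖∇Ψ'(v)‖² dμ)^{1/2} ≤ C √(1+G)` by Cauchy–Schwarz, use the defect clause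
`∫ ⟨f − B(v,v), Ψ'(v)⟩ dμ ≤ R X`, and choose `Λ := 2C(1+G)/γ` AFTER seeing `μ`: `γ/2 ≤ C √(1+G) R`,
i.e. `R √G ≥ γ/(4C)` when `G ≥ 1` and `R > γ/(4C) = δ₀` (excluded) when `G < 1`. [folklore] -/
theorem stub_weakDuality (f : Vec3) (E γ C : ℝ) (hE : 0 < E) (hγ : 0 < γ) (hC : 0 < C)
    (hfam : ∀ Λ : ℝ, 0 < Λ → ∃ (Ψ : Torus.CylindricalTest (Fin 3)) (a b : ℝ), 0 ≤ b ∧ γ ≤ a - b * E ∧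
      (∀ v : H3, Torus.gradNormSq (Ψ.grad v) ≤
        C ^ 2 * (1 + (Torus.eGradNormSq ((v : L2) : Vec3)).toReal)) ∧
      (∀ v : H3, Torus.eGradNormSq ((v : L2) : Vec3) ≠ ⊤ →
        a - b * ‖v‖ ^ 2 -
            Λ⁻¹ * (Real.sqrt (Torus.eGradNormSq ((v : L2) : Vec3)).toReal *
              Real.sqrt (Torus.gradNormSq (Ψ.grad v))) ≤
          Torus.nsGeneratorPairing 0 f v (Ψ.grad v))) :
    ∃ c δ₀ : ℝ, 0 < c ∧ 0 < δ₀ ∧ ∀ μ : Measure H3, IsProbabilityMeasure μ →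
      Integrable (fun v : H3 => ‖v‖ ^ 2) μ → Torus.ensembleEnergy μ ≤ E → Torus.ensembleEnstrophy μ < ⊤ →
      ∀ R : ℝ, 0 ≤ R → R ≤ δ₀ →
        (∀ Φ : Torus.CylindricalTest (Fin 3),
          Integrable (fun v : H3 => Torus.nsGeneratorPairing 0 f v (Φ.grad v)) μ ∧
            |∫ v, Torus.nsGeneratorPairing 0 f v (Φ.grad v) ∂μ| ≤
              R * Real.sqrt (∫ v, Torus.gradNormSq (Φ.grad v) ∂μ)) →
        c ≤ R * Real.sqrt (Torus.ensembleEnstrophy μ).toReal := by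
  have _ := hE -- the level `E > 0` is not needed for the duality itself
  refine ⟨γ / (4 * C), γ / (4 * C), by positivity, by positivity, ?_⟩
  intro μ hμ hint hEμ hGfin R hR0 hRδ hdef
  -- the roughness scale `Λ := 2C(1+G)/γ` is chosen after seeing `μ`
  have hG0 : 0 ≤ (Torus.ensembleEnstrophy μ).toReal := ENNReal.toReal_nonneg
  have hΛ : 0 < (γ / (2 * C * (1 + (Torus.ensembleEnstrophy μ).toReal)))⁻¹ := by positivity
  obtain ⟨Ψ, a, b, hb, hab, hcost, hcert⟩ := hfam _ hΛ
  obtain ⟨hdefI, hdefΨ⟩ := hdef Ψ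
  have hcore := weakDuality_integrate f μ hint hGfin Ψ hΛ hC hR0 hcost hcert hdefI hdefΨ
  rw [inv_inv] at hcore
  exact weakDuality_arith (E := E) hγ hC hR0 hRδ hG0 hb hab hEμ hcore

end Summit.AnomalousDissipation.AnomalousDissipation.Theorems.EnsembleRigidity.GPStatisticalRigidity

end
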